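import Summits.Ventures.PercRepro.C026PinnedDefs

/-!
# Pinning composes at the pinned vertex: M3-PINCOMP in Lean (p6, gen 9)

mine-3's theorem (`proofs/MINE3-Q3-proof.md` §27.14, statement sheet §27.16): if `G` is a gluing at
`a, b, c, x` and the package `P(x) = [D_K(x) ≥ 0 ∧ Δ_{R→K}(x) ≥ 0]` holds for both parts, it holds for
`G`.  With the merged graph `G′ = G.mergeInto x a` (a 3-terminal gluing by (P0)) the proof is the
composition theorem's counting step on `G′`:

* **(P3)** `pinK_eq_sum` / `pinRK_eq_sum` — the pin sums as double sums over the parts' configurations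
  (`sideEquiv`), the witness `x ~ a` split by colour through (P2);
* **(P4)** the pointwise inequality is `summand_le` on `G′`, whose parts are the parts' merged graphs (P1);
* **(P5)** the arithmetic: `[w₁ ∨ w₀] = [w₁] + [¬w₁]·[w₀]` and `[¬w₁ ∧ ¬w₀] = [¬w₁]·[¬w₀]` turn the
  double sums into products of one-sided sums — the parts' `pinK`, `pinRK`, their sum, and
  nonnegative indicator sums — so `pinK G ≥ 0` and `pinRK G ≥ 0` follow from the parts' packages;
* **`pinPackage_of_gluing4`** — the theorem of record.
-/

namespace PercRepro

namespace MultiGraph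

section PinnedCount

variable {V E : Type*} [Fintype E] [DecidableEq E] (G : MultiGraph V E) {a b c x : V}
  {side : E → Bool}

open Classical in
/-- **(P3)** `D_K(x)` of a 4-terminal gluing as a double sum over the parts' configurations: the
witness `x ~ a` is a witness of one of the parts. -/
theorem pinK_eq_sum (hxb : x ≠ b) (hxc : x ≠ c) (hg : G.IsGluing4 a b c x side) :
    G.pinK a b c x =
      ∑ ω₁ : Config {e // side e = true}, ∑ ω₀ : Config {e // side e = false},
        (if (G.part side true).Conn ω₁ x a ∨ (G.part side false).Conn ω₀ x a then (1 : ℤ) else 0) *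
          (if (G.mergeInto x a).IsBot ((sideEquiv side).symm (ω₁, ω₀)) a b c then
            (G.mergeInto x a).hScore ((sideEquiv side).symm (ω₁, ω₀)) a b c else 0) := by
  unfold pinK
  rw [← (sideEquiv side).symm.sum_comp, Fintype.sum_prod_type]
  refine Finset.sum_congr rfl fun ω₁ _ => Finset.sum_congr rfl fun ω₀ _ => ?_
  by_cases hb : (G.mergeInto x a).IsBot ((sideEquiv side).symm (ω₁, ω₀)) a b c
  · have hw := conn_x_iff hg hxb hxc hb
    simp only [sideRestrict_symm_true, sideRestrict_symm_false] at hw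
    by_cases h : G.Conn ((sideEquiv side).symm (ω₁, ω₀)) x a
    · rw [if_pos ⟨hb, h⟩, if_pos (hw.mp h), if_pos hb, one_mul]
    · rw [if_neg (fun h' => h h'.2), if_neg (fun h' => h (hw.mpr h')), zero_mul]
  · rw [if_neg (fun h' => hb h'.1), if_neg hb, mul_zero]

open Classical in
/-- **(P3)** `Δ_{R→K}(x)` of a 4-terminal gluing as a double sum over the parts' configurations: no
part joins `x` to `a`. -/
theorem pinRK_eq_sum (hxb : x ≠ b) (hxc : x ≠ c) (hg : G.IsGluing4 a b c x side) :
    G.pinRK a b c x =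
      ∑ ω₁ : Config {e // side e = true}, ∑ ω₀ : Config {e // side e = false},
        (if ¬ ((G.part side true).Conn ω₁ x a ∨ (G.part side false).Conn ω₀ x a) then (1 : ℤ)
          else 0) *
          (if (G.mergeInto x a).IsBot ((sideEquiv side).symm (ω₁, ω₀)) a b c then
            (G.mergeInto x a).hScore ((sideEquiv side).symm (ω₁, ω₀)) a b c else 0) := by
  unfold pinRK
  rw [← (sideEquiv side).symm.sum_comp, Fintype.sum_prod_type]
  refine Finset.sum_congr rfl fun ω₁ _ => Finset.sum_congr rfl fun ω₀ _ => ?_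
  by_cases hb : (G.mergeInto x a).IsBot ((sideEquiv side).symm (ω₁, ω₀)) a b c
  · have hw := conn_x_iff hg hxb hxc hb
    simp only [sideRestrict_symm_true, sideRestrict_symm_false] at hw
    by_cases h : G.Conn ((sideEquiv side).symm (ω₁, ω₀)) x a
    · rw [if_neg (fun h' => h'.2 h), if_neg (fun h' => h' (hw.mp h)), zero_mul]
    · rw [if_pos ⟨hb, h⟩, if_pos (fun h' => h (hw.mpr h')), if_pos hb, one_mul]
  · rw [if_neg (fun h' => hb h'.1), if_neg hb, mul_zero]

open Classical in
/-- **(P5, the `D_K` summand)** The witness indicator splits as `[p ∨ q] = [p] + [¬p]·[q]`: a pointwise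
bound `A·S₀ + S₁·C ≤ T` gives the bound on the `[p ∨ q]`-gated summand by the four gated products. -/
theorem pinK_summand_bound (p q : Prop) {A S₀ S₁ C T : ℤ} (h : A * S₀ + S₁ * C ≤ T) :
    (if p then (1 : ℤ) else 0) * A * S₀ + (if p then (1 : ℤ) else 0) * S₁ * C +
      (if p then (0 : ℤ) else 1) * A * ((if q then (1 : ℤ) else 0) * S₀) +
      (if p then (0 : ℤ) else 1) * S₁ * ((if q then (1 : ℤ) else 0) * C) ≤
    (if p ∨ q then (1 : ℤ) else 0) * T := by
  by_cases hp : p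
  · simp only [if_pos hp, if_pos (Or.inl hp : p ∨ q)]
    linarith
  · by_cases hq : q
    · simp only [if_neg hp, if_pos hq, if_pos (Or.inr hq : p ∨ q)]
      linarith
    · simp only [if_neg hp, if_neg hq, if_neg (not_or.mpr ⟨hp, hq⟩ : ¬ (p ∨ q))]
      linarith

open Classical in
/-- **(P5, the `Δ_{R→K}` summand)** `[¬(p ∨ q)] = [¬p]·[¬q]`: a pointwise bound `A·S₀ + S₁·C ≤ T`
gives the bound on the `[¬(p ∨ q)]`-gated summand by the two gated products. -/
theorem pinRK_summand_bound (p q : Prop) {A S₀ S₁ C T : ℤ} (h : A * S₀ + S₁ * C ≤ T) :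
    (if p then (0 : ℤ) else 1) * A * ((if q then (0 : ℤ) else 1) * S₀) +
      (if p then (0 : ℤ) else 1) * S₁ * ((if q then (0 : ℤ) else 1) * C) ≤
    (if ¬ (p ∨ q) then (1 : ℤ) else 0) * T := by
  by_cases hp : p
  · simp only [if_pos hp, if_neg (not_not_intro (Or.inl hp : p ∨ q))]
    linarith
  · by_cases hq : q
    · simp only [if_neg hp, if_pos hq, if_neg (not_not_intro (Or.inr hq : p ∨ q))]
      linarith
    · simp only [if_neg hp, if_neg hq, if_pos (not_or.mpr ⟨hp, hq⟩ : ¬ (p ∨ q))]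
      linarith

open Classical in
/-- **THE THEOREM (M3-PINCOMP, §27.14): pinning composes at the pinned vertex.**  If `G` is a gluing
at `a, b, c, x` and the package `P(x) = [D_K(x) ≥ 0 ∧ Δ_{R→K}(x) ≥ 0]` holds for both parts, it holds
for `G`.  Proof: on the merged graph `G′` (a 3-terminal gluing), the pointwise inequality `summand_le`
bounds every summand of the double sums (P3) below by `A₁·S₀ + S₁·C₀` (the parts' merged scores `S`
against the nonnegative indicators `A`, `C` of the composition theorem); splitting the witness
indicator `[w₁ ∨ w₀] = [w₁] + [¬w₁][w₀]` (resp. `[¬w₁ ∧ ¬w₀] = [¬w₁][¬w₀]`) and summing gives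
`pinK G ≥ (Σ[w₁]A)(pinK G₀ + pinRK G₀) + pinK G₁·(ΣC) + (Σ[¬w₁]A)·pinK G₀ + pinRK G₁·(Σ[w₀]C) ≥ 0` and
`pinRK G ≥ (Σ[¬w₁]A)·pinRK G₀ + pinRK G₁·(Σ[¬w₀]C) ≥ 0`. -/
theorem pinPackage_of_gluing4 (a b c x : V) (hab : a ≠ b) (hac : a ≠ c) (hbc : b ≠ c) (hxa : x ≠ a)
    (hxb : x ≠ b) (hxc : x ≠ c) (side : E → Bool) (hg : G.IsGluing4 a b c x side)
    (h₁ : (G.part side true).PinPackage a b c x) (h₀ : (G.part side false).PinPackage a b c x) :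
    G.PinPackage a b c x := by
  have hg' : (G.mergeInto x a).IsGluing a b c side := isGluing_mergeInto hxa hg
  obtain ⟨hK₁, hRK₁⟩ := h₁
  obtain ⟨hK₀, hRK₀⟩ := h₀
  unfold PinPackage
  rw [pinK_eq_sum G hxb hxc hg, pinRK_eq_sum G hxb hxc hg]
  -- the parts' quantities (on the merged parts, which are the parts of the merged graph by (P1))
  set A : Config {e // side e = true} → ℤ := fun ω₁ =>
    if ((G.mergeInto x a).part side true).IsBot ω₁ a b c then
      (if ¬ ((G.mergeInto x a).part side true).HO1 ω₁ a b c ∧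
          ¬ ((G.mergeInto x a).part side true).HO2 ω₁ a b c then (1 : ℤ) else 0)
    else 0 with hA
  set S₁ : Config {e // side e = true} → ℤ := fun ω₁ =>
    if ((G.mergeInto x a).part side true).IsBot ω₁ a b c then
      ((G.mergeInto x a).part side true).hScore ω₁ a b c else 0 with hS₁
  set S₀ : Config {e // side e = false} → ℤ := fun ω₀ =>
    if ((G.mergeInto x a).part side false).IsBot ω₀ a b c then
      ((G.mergeInto x a).part side false).hScore ω₀ a b c else 0 with hS₀
  set C : Config {e // side e = false} → ℤ := fun ω₀ =>
    if ((G.mergeInto x a).part side false).IsBot ω₀ a b c then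
      (if (((G.mergeInto x a).part side false).HBad ω₀ a b c ↔
          ((G.mergeInto x a).part side false).HO1 ω₀ a b c ∧
            ((G.mergeInto x a).part side false).HO2 ω₀ a b c) then (1 : ℤ) else 0)
    else 0 with hC
  set W₁ : Config {e // side e = true} → ℤ := fun ω₁ =>
    if (G.part side true).Conn ω₁ x a then 1 else 0 with hW₁
  set N₁ : Config {e // side e = true} → ℤ := fun ω₁ =>
    if (G.part side true).Conn ω₁ x a then 0 else 1 with hN₁
  set W₀ : Config {e // side e = false} → ℤ := fun ω₀ =>
    if (G.part side false).Conn ω₀ x a then 1 else 0 with hW₀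
  set N₀ : Config {e // side e = false} → ℤ := fun ω₀ =>
    if (G.part side false).Conn ω₀ x a then 0 else 1 with hN₀
  set T : Config {e // side e = true} → Config {e // side e = false} → ℤ := fun ω₁ ω₀ =>
    if (G.mergeInto x a).IsBot ((sideEquiv side).symm (ω₁, ω₀)) a b c then
      (G.mergeInto x a).hScore ((sideEquiv side).symm (ω₁, ω₀)) a b c else 0 with hT
  -- (P4) the pointwise inequality of the composition theorem on the merged graph
  have key : ∀ ω₁ ω₀, A ω₁ * S₀ ω₀ + S₁ ω₁ * C ω₀ ≤ T ω₁ ω₀ := by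
    intro ω₁ ω₀
    have h := summand_le hg' hab hac hbc ((sideEquiv side).symm (ω₁, ω₀))
    simp only [sideRestrict_symm_true, sideRestrict_symm_false] at h
    exact h
  -- the parts' pin sums in terms of the abbreviations
  have hK₁' : (G.part side true).pinK a b c x = ∑ ω₁, W₁ ω₁ * S₁ ω₁ := by
    unfold pinK
    rw [part_mergeInto]
    refine Finset.sum_congr rfl fun ω₁ _ => ?_
    simp only [hW₁, hS₁]
    by_cases hw : (G.part side true).Conn ω₁ x a <;>
      by_cases hb : ((G.mergeInto x a).part side true).IsBot ω₁ a b c <;> simp [hw, hb]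
  have hRK₁' : (G.part side true).pinRK a b c x = ∑ ω₁, N₁ ω₁ * S₁ ω₁ := by
    unfold pinRK
    rw [part_mergeInto]
    refine Finset.sum_congr rfl fun ω₁ _ => ?_
    simp only [hN₁, hS₁]
    by_cases hw : (G.part side true).Conn ω₁ x a <;>
      by_cases hb : ((G.mergeInto x a).part side true).IsBot ω₁ a b c <;> simp [hw, hb]
  have hK₀' : (G.part side false).pinK a b c x = ∑ ω₀, W₀ ω₀ * S₀ ω₀ := by
    unfold pinK
    rw [part_mergeInto]
    refine Finset.sum_congr rfl fun ω₀ _ => ?_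
    simp only [hW₀, hS₀]
    by_cases hw : (G.part side false).Conn ω₀ x a <;>
      by_cases hb : ((G.mergeInto x a).part side false).IsBot ω₀ a b c <;> simp [hw, hb]
  have hRK₀' : (G.part side false).pinRK a b c x = ∑ ω₀, N₀ ω₀ * S₀ ω₀ := by
    unfold pinRK
    rw [part_mergeInto]
    refine Finset.sum_congr rfl fun ω₀ _ => ?_
    simp only [hN₀, hS₀]
    by_cases hw : (G.part side false).Conn ω₀ x a <;>
      by_cases hb : ((G.mergeInto x a).part side false).IsBot ω₀ a b c <;> simp [hw, hb]
  have hS₀sum : ∑ ω₀, S₀ ω₀ = (G.part side false).pinK a b c x + (G.part side false).pinRK a b c x := by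
    rw [hK₀', hRK₀', ← Finset.sum_add_distrib]
    refine Finset.sum_congr rfl fun ω₀ _ => ?_
    simp only [hW₀, hN₀]
    by_cases hw : (G.part side false).Conn ω₀ x a <;> simp [hw]
  -- the indicator sums are nonnegative
  have hWA : 0 ≤ ∑ ω₁, W₁ ω₁ * A ω₁ := Finset.sum_nonneg fun ω₁ _ => by
    simp only [hW₁, hA]
    split_ifs <;> norm_num
  have hNA : 0 ≤ ∑ ω₁, N₁ ω₁ * A ω₁ := Finset.sum_nonneg fun ω₁ _ => by
    simp only [hN₁, hA]
    split_ifs <;> norm_num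
  have hCnn : 0 ≤ ∑ ω₀, C ω₀ := Finset.sum_nonneg fun ω₀ _ => by
    simp only [hC]
    split_ifs <;> norm_num
  have hWC : 0 ≤ ∑ ω₀, W₀ ω₀ * C ω₀ := Finset.sum_nonneg fun ω₀ _ => by
    simp only [hW₀, hC]
    split_ifs <;> norm_num
  have hNC : 0 ≤ ∑ ω₀, N₀ ω₀ * C ω₀ := Finset.sum_nonneg fun ω₀ _ => by
    simp only [hN₀, hC]
    split_ifs <;> norm_num
  constructor
  · -- `D_K(x) ≥ 0`
    calc (0 : ℤ)
        ≤ (∑ ω₁, W₁ ω₁ * A ω₁) * (∑ ω₀, S₀ ω₀) + (∑ ω₁, W₁ ω₁ * S₁ ω₁) * (∑ ω₀, C ω₀) +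
            (∑ ω₁, N₁ ω₁ * A ω₁) * (∑ ω₀, W₀ ω₀ * S₀ ω₀) +
            (∑ ω₁, N₁ ω₁ * S₁ ω₁) * (∑ ω₀, W₀ ω₀ * C ω₀) := by
          rw [hS₀sum, ← hK₁', ← hK₀', ← hRK₁']
          exact add_nonneg (add_nonneg (add_nonneg (mul_nonneg hWA (add_nonneg hK₀ hRK₀))
            (mul_nonneg hK₁ hCnn)) (mul_nonneg hNA hK₀)) (mul_nonneg hRK₁ hWC)
      _ = ∑ ω₁, ∑ ω₀, (W₁ ω₁ * A ω₁ * S₀ ω₀ + W₁ ω₁ * S₁ ω₁ * C ω₀ +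
            N₁ ω₁ * A ω₁ * (W₀ ω₀ * S₀ ω₀) + N₁ ω₁ * S₁ ω₁ * (W₀ ω₀ * C ω₀)) := by
          simp only [Finset.sum_mul_sum, Finset.sum_add_distrib]
      _ ≤ ∑ ω₁, ∑ ω₀,
            (if (G.part side true).Conn ω₁ x a ∨ (G.part side false).Conn ω₀ x a then (1 : ℤ)
              else 0) * T ω₁ ω₀ := by
          refine Finset.sum_le_sum fun ω₁ _ => Finset.sum_le_sum fun ω₀ _ => ?_
          simp only [hW₁, hN₁, hW₀]
          exact pinK_summand_bound _ _ (key ω₁ ω₀)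
  · -- `Δ_{R→K}(x) ≥ 0`
    calc (0 : ℤ)
        ≤ (∑ ω₁, N₁ ω₁ * A ω₁) * (∑ ω₀, N₀ ω₀ * S₀ ω₀) +
            (∑ ω₁, N₁ ω₁ * S₁ ω₁) * (∑ ω₀, N₀ ω₀ * C ω₀) := by
          rw [← hRK₀', ← hRK₁']
          exact add_nonneg (mul_nonneg hNA hRK₀) (mul_nonneg hRK₁ hNC)
      _ = ∑ ω₁, ∑ ω₀, (N₁ ω₁ * A ω₁ * (N₀ ω₀ * S₀ ω₀) + N₁ ω₁ * S₁ ω₁ * (N₀ ω₀ * C ω₀)) := by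
          simp only [Finset.sum_mul_sum, Finset.sum_add_distrib]
      _ ≤ ∑ ω₁, ∑ ω₀,
            (if ¬ ((G.part side true).Conn ω₁ x a ∨ (G.part side false).Conn ω₀ x a) then (1 : ℤ)
              else 0) * T ω₁ ω₀ := by
          refine Finset.sum_le_sum fun ω₁ _ => Finset.sum_le_sum fun ω₀ _ => ?_
          simp only [hN₁, hN₀]
          exact pinRK_summand_bound _ _ (key ω₁ ω₀)

end PinnedCount

end MultiGraph

end PercRepro
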